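import Mathlib
import Literature.MathematicalPhysics.QuantumFieldTheory.Balaban1983to89.B14RelAnimalBound
import Literature.MathematicalPhysics.QuantumFieldTheory.Balaban1983to89.TreeLength
import Literature.MathematicalPhysics.QuantumFieldTheory.Balaban1983to89.TreeLengthCubeSystem

/-!
# `Balaban1983to89.B14.RelTreeLength` — the relative linear size d_{k,Z}(Y) of [Balaban1989LargeFieldII] (1.67) p. 376
on the continuum model of `…TreeLength`, the RELATIVE STEINER-ANIMAL LEAF `B14.RelAnimal.RelCubeSystem.RelAnimalLeaf`
KERNEL-PROVED for the cubes of ℤ^d with corner adjacency, and a CONCRETE carrier on which Lemma E.3 of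
[Dimock2013BalabanII] (`relTreeBound`, `sumsum`) and the per-scale bound of [Balaban1988Convergent] (2.48)
(`scaleBound_Gamma`) hold UNCONDITIONALLY

CITATION HEADER (lean-in-tree rule 2026-08-18).  Sources: T. Bałaban, *Large field renormalization. II. Localization,
exponentiation, and bounds for the 𝐑 operation*, Commun. Math. Phys. **122**, 355–392 (1989) [Balaban1989LargeFieldII]
(cell paper B16; held `paper:balaban1989-cmp122-large-field-ii`, journal page = PDF page + 354); T. Bałaban, *Convergent
renormalization expansions for lattice gauge theories*, Commun. Math. Phys. **119**, 243–285 (1988)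
[Balaban1988Convergent] (cell paper B14 = [III]; journal page = PDF page + 242); T. Bałaban, *Renormalization group
approach to lattice gauge field theories. I*, Commun. Math. Phys. **109**, 249–301 (1987) [Balaban1987RG1] ([I]);
J. Dimock, *The renormalization group according to Bałaban II. Large fields*, J. Math. Phys. **54**, 092301 (2013),
arXiv:1212.5562v2 [Dimock2013BalabanII] (held TeX source, cell folder `inputs/files/dimock/src/1212.5562/`, line numbers
`L…` below).  The Bałaban papers are manuscripts UNDER ADJUDICATION by the audit cell `pub-balaban`: nothing printed in
them is asserted here.  Every `theorem` below is elementary geometry of unit cubes and segments in ℝ^d or finite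
combinatorics, proved without `sorry` and without new axioms.  NEW satellite module of unit `b2b-balaban-b01` (gen 4;
cell GAPS.md C-b01-J5): it imports and does not modify `…B14RelAnimalBound` (this unit, gen 3: the carrier
`RelCubeSystem`, the leaf `RelAnimalLeaf`, `relTreeBound`, `sumsum`, `relAnchoredBound`, `scaleBound_Gamma`),
`…TreeLength` (unit pv22: `cube`, `carrier`, `len`, `Admissible`, `treeLen`, `SAdmissible`, `card_le_of_sAdmissible_len`)
and `…TreeLengthCubeSystem` (unit pv22: the window systems `sys B`, `Dom B`, `Cell B`, `cellsOf`).

WHAT IS PRINTED.  B16 p. 376 [22] (1.67), verbatim (render p022): *"Introduce the following definition of the relative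
linear size d_{k,Z}(Y) of a domain Y ∈ 𝐃_k: d_{k,Z}(Y) = M⁻¹ (the length of a shortest tree graph contained in Y and
intersecting all M-cubes of the components of Y∖Z). (1.67)"*.  [I] p. 257 [9], verbatim: *"Consider a class of tree
graphs contained in X and intersecting all the cubes in X. A length of a shortest graph in this class, divided by M, is
the linear size of X, and is denoted by d_j(X)"*; *"For a cube □ ∈ π_j and n = 1, 2, … we define □̃ⁿ as a cube of the
size (1+2n)M and with a center at the center of □ … The meaning of the symbol X̃ⁿ should be obvious"*.  [III] p. 255
[13] (2.3) *"Z_j = Λ_j^c"*; p. 254 [12] (2.1) *"Ω_1 ⊃ Λ_1 ⊃ Ω_2 ⊃ …"*; p. 259 [17] *"Λ_j^0 the set which is obtained by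
removing one layer of the MR_j-cubes from Λ_j^{(j)}"*; p. 261 [19] (2.41) *"where the sum is over domains X ∈ 𝐃_j such,
that X∩Ω_j ≠ ∅, and X∩Z_j^~ ≠ ∅"*; p. 262 [20], second paragraph (quoted WHOLE): *"There are other possible forms of
the inductive assumptions for the boundary terms. For example, we may resum all the terms with localization domains
intersecting a given component of the large field region. This gives sum (2.41), with the summation over domains
X ∈ 𝐃_j such that X either contains a component of the large field region Z_j, or is disjoint with it. Resumming we
lose a part of the exponential factor in (2.42), connected with the region Z_j; hence for the new terms we obtain the
bound (2.42) with d_j(X) replaced by d_j(X∖Z_j). All constructions and proofs of the procedure can be carried on with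
these inductive assumptions. We have chosen the ones above, because they agree with the assumptions for 𝐄-terms and
𝐑-terms."* (closing sentence: the alternative is printed AND DECLINED by [III]; it is the form [Balaban1989LargeFieldII]
(1.99) delivers — cell GAPS G-ref1-9; this module, like `…B14RelBoundary`/`…B14RelAnimalBound`, types the alternative).
[Dimock2013BalabanII] App. E (L6779–6788), verbatim: *"Let Y
be a collection of M-blocks □ in a lattice of dimension d. Y is not necessarily connected. … M ℓ̃_M(Y) is the length
of a minimal tree whose vertices are one point from each block in Y and possibly other points. … But we do have
ℓ̃_M(Y) ≤ d_M(Y)"*, Lemma E.1 (L6790–6798) *"1. ℓ_M(Y) ≤ 2ℓ̃_M(Y)  2. ℓ′_M(Y) ≤ ℓ_M(Y) + |Y|_M  3. |Y|_M ≤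
4(2^d+1)(ℓ_M(Y)+1)"*, its proof (L6820) *"since at most 2^d blocks be mutually touching"*, and Lemma E.3 (L6914–6920)
*"Let Ω be a union of M-cubes. For □ ⊂ Ω and constants κ₀, K₀ = 𝒪(1):  Σ_{X ∈ 𝒟_k(mod Ω^c), X ⊃ □} exp(−κ₀ d_M(X, mod
Ω^c)) ≤ K₀"*.

WHAT THIS FILE TYPES AND PROVES (cell GAPS.md C-b01-J5; discharges the quoted leaf of C-b01-J4 on a concrete carrier).
* §1 CORNER ADJACENCY `CAdj x y` (x ≠ y, |x_i − y_i| ≤ 1 for all i: the cube y is one of the 3^d − 1 cubes of □̃(x)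
  other than x, [I] p. 257), symmetric, implied by the common-wall adjacency `B13ScaleTransfer.Adj`; two distinct unit
  cubes with a common point are corner-adjacent (`cadj_of_mem_cube`); `B13ScaleTransfer.collar Z` (= Z̃) is Z plus its corner-neighbours
  (`mem_collar_iff`); the corner-neighbour list `cnbr` in a window has ≤ 3^d − 1 members (`card_cnbr_le`).
* §2 THE RELATIVE LINEAR SIZE (1.67) on pv22's continuum model (closed unit cubes `TreeLength.cube`, polygonal graphs
  `carrier`/`len`, sup metric): `RAdmissible X S T` — the graph is connected, contained in the cubes of X, and meets
  every cube of the family S (the printed "M-cubes of the components of Y∖Z"; here S is a parameter, instantiated as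
  `X∖Z` in §5); `relTreeLen X S := sInf` of the lengths (junk value 0 on an empty class, as `treeLen`); `0 ≤ relTreeLen`,
  `relTreeLen X S ≤ treeLen X` for S ⊆ X and X a domain, `relTreeLen X X = treeLen X` (so d_{k,Z}(Y) = d_k(Y) when Y∖Z =
  Y, the clause `dRel_eq_of_not_meets` of unit b02's `B16.RelDomainSys`).
* §3 THE MET FAMILY `met X T` = the cubes of X meeting the graph T: it is Steiner-admissible for T (`sAdmissible_met`),
  hence `#met X T ≤ 2^d(4|T| + 1)` by pv22's `card_le_of_sAdmissible_len` (Lemma E.1 (3) mechanism); and it is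
  CORNER-CONNECTED (`met_chain`, `isRConnected_met`): the closed cubes of a corner-component C of the met family and those
  of the rest cover the connected carrier, so (`isPreconnected_closed_iff`) some point of the graph lies in a cube of C
  and in a cube outside C — two cubes with a common point are corner-adjacent, contradiction.  (The met family is in
  general NOT common-wall connected: a diagonal segment from □(0,0) to □(1,1) meets only these two cubes — which is why
  gen 3's carrier field `Adj` is instantiated with corner adjacency, Δ = 3^d − 1.)
* §4 THE RELATIVE ANIMAL (`exists_relAnimal`): for S ⊆ X with a non-empty relative class there is a corner-connected
  family A with S ⊆ A ⊆ X and `#A ≤ 2^d(4·relTreeLen X S + 1)` — the met family of a graph of the class with the FEWEST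
  met cubes (the infimum (1.67) need not be attained, but the met-cube count is a natural number: `Nat.sInf_mem`), bounded
  through every graph of the class by §3 and `le_relTreeLen`.
* §5 THE CONCRETE CARRIER of one scale j: a `Window` = finite families `B ⊇ Ω_j ⊇ Λ_j ⊇ Λ_j^0` of cubes of ℤ^d with the
  located layer property (a corner-neighbour in B of a cube of Λ_j^0 lies in Λ_j, p. 259), `Z := B∖Λ_j` ((2.3) inside the
  window); `Window.relSys : B16.RelDomainSys` = pv22's `TreeLengthCubeSystem.sys B` (domains = non-empty common-wall
  connected X ⊆ B, `dj = treeLen`) with `dRel X := relTreeLen X (X∖Z)` and `MeetsLF X := X ∩ Z ≠ ∅` (all three clauses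
  PROVED); `Window.relCubeSys : B14.RelAnimal.RelCubeSystem relSys` with cubes `Cell B`, `Adj` = corner adjacency, the sets
  `cellsOf B Ω_j | Λ_j | Λ_j^0 | Z` and `adm` = the domains X with p. 262's closure property (a Z-cube corner-adjacent to a
  Z-cube of X is in X), `X ∩ Ω_j ≠ ∅` and `X ∩ Z̃ ≠ ∅` (Z̃ = `B13ScaleTransfer.collar Z`, [I] p. 257) — every structure field PROVED.
* §6 THE LEAF AND THE BOUNDS, UNCONDITIONAL on this carrier: `Window.degreeLE` (Δ = 3^d − 1), `Window.relAnimalLeaf :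
  relCubeSys.RelAnimalLeaf (4·2^d)` (from §4: `2^d(4r+1) ≤ 4·2^d(1+r)`), hence by gen 3's theorems `Window.relTreeBound` /
  `Window.sumsum` (LEMMA E.3 / [Dimock2013BalabanII] (snow) for the relative size (1.67) on ℤ^d windows, constants
  `κ ≥ RelAnimal.kapparel(4·2^d, 3^d−1)`, `K₀ = RelAnimal.Krel(4·2^d, 3^d−1)`), `Window.relAnchoredBound` (hypothesis H4 of gen 2's
  `B14.RelBoundary` DISCHARGED) and `Window.scaleBound_Gamma` (the per-scale input of (2.48): termwise *"(2.42) with d_j(X)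
  replaced by d_j(X∖Z_j)"* ⇒ `‖Σ_{X∈adm} 𝐁(X)‖ ≤ B₀(RelAnimal.Krel+1)·#(Ω_j∖Ω_{j+1})`); d = 4: c₀ = 64, Δ = 80,
  `RelAnimal.kapparel 64 80 = 64(log 13122 + 81 log 2) < 4215` (`kapparel_four_lt`; print: "κ sufficiently large").

CONVENTIONS / NOT TYPED HERE.  (i) As in `…TreeLength`: closed unit cubes (M = 1 after rescaling), connected finite
unions of segments in place of tree graphs, sup metric, infimum instead of minimum.  (ii) "the components of Y∖Z" in
(1.67) is read as "the M-cubes of Y∖Z" (a tree meets all cubes of the components of Y∖Z iff it meets every cube of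
Y∖Z).  (iii) The window is a finite family of cubes of ℤ^d, not of the torus T_{L^{−j}} (as in pv22's
`TreeLengthCubeSystem`; cell DIVERGENCE D-b01.7).  (iv) p. 262's "contains a component of Z_j or is disjoint with it" is
typed with CORNER-components of the family Z (the components of the closed set ⋃Z are exactly these, by
`cadj_of_mem_cube`; not needed and not proved here).  Not typed: the bounds (2.42)/(1.99) themselves, the 𝐓-step, the
torus.  Value = kernel discharge of a quoted leaf on a concrete carrier + located published source, NOT summit progress.
-/

namespace Literature.MathematicalPhysics.QuantumFieldTheory.Balaban1983to89.B14.RelTreeLength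

noncomputable section

open Literature.MathematicalPhysics.QuantumFieldTheory.Balaban1983to89
open Literature.MathematicalPhysics.QuantumFieldTheory.Balaban1983to89.B13ScaleTransfer
open Literature.MathematicalPhysics.QuantumFieldTheory.Balaban1983to89.TreeLength
open Literature.MathematicalPhysics.QuantumFieldTheory.Balaban1983to89.TreeLengthCubeSystem
open Literature.Probability.LatticeModels (IsRConnected rcomponent mem_rcomponent mem_rcomponent_self rcomponent_subset)

variable {d : ℕ}

/-! ## 1. Corner adjacency of cubes of ℤ^d -/

/-- CORNER ADJACENCY of two cubes of ℤ^d: distinct indices at sup-distance ≤ 1, i.e. `y` is one of the cubes of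
`□̃(x)` (`B13ScaleTransfer.block x`, [Balaban1987RG1] p. 257 *"□̃ⁿ as a cube of the size (1+2n)M and with a center at
the center of □"*, n = 1) other than `x`; equivalently the closed cubes are distinct and intersect.  This is the
instantiation of the abstract `Adj` of `B14.RelAnimal.RelCubeSystem` announced in its docstring (i)–(iv). [cite: Balaban1987RG1, p.257 (definition of □̃ⁿ)] -/
def CAdj (x y : Pt d) : Prop := x ≠ y ∧ y ∈ B13ScaleTransfer.block x

/-- Membership in `□̃` is symmetric in the two indices. [folklore] -/
theorem mem_block_comm {x y : Pt d} : y ∈ B13ScaleTransfer.block x ↔ x ∈ B13ScaleTransfer.block y := by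
  simp only [B13ScaleTransfer.mem_block]
  constructor
  · intro h i
    obtain ⟨h1, h2⟩ := h i
    constructor <;> linarith
  · intro h i
    obtain ⟨h1, h2⟩ := h i
    constructor <;> linarith

/-- Corner adjacency is symmetric. [folklore] -/
theorem CAdj.symm {x y : Pt d} (h : CAdj x y) : CAdj y x :=
  ⟨fun e => h.1 e.symm, mem_block_comm.1 h.2⟩

/-- Two cubes with a common wall are corner-adjacent. [folklore] -/
theorem cadj_of_adj {x y : Pt d} (h : Adj x y) : CAdj x y := by
  have key : ∀ {a b : Pt d} (i : Fin d), b = Function.update a i (a i + 1) →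
      a ≠ b ∧ b ∈ B13ScaleTransfer.block a ∧ a ∈ B13ScaleTransfer.block b := by
    intro a b i hb
    have hi : b i = a i + 1 := by rw [hb, Function.update_self]
    have hj : ∀ j, j ≠ i → b j = a j := fun j hj => by rw [hb, Function.update_of_ne hj]
    refine ⟨fun hab => ?_, B13ScaleTransfer.mem_block.2 fun j => ?_, B13ScaleTransfer.mem_block.2 fun j => ?_⟩
    · rw [hab] at hi
      linarith
    · by_cases h : j = i
      · subst h
        constructor <;> linarith
      · rw [hj j h]
        constructor <;> linarith
    · by_cases h : j = i
      · subst h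
        constructor <;> linarith
      · rw [hj j h]
        constructor <;> linarith
  obtain ⟨i, h | h⟩ := h
  · obtain ⟨hne, hb, -⟩ := key i h
    exact ⟨hne, hb⟩
  · obtain ⟨hne, -, ha⟩ := key i h
    exact ⟨fun e => hne e.symm, ha⟩

/-- Two DISTINCT closed unit cubes with a common point are corner-adjacent ([Dimock2013BalabanII] App. E, L6820:
*"at most 2^d blocks be mutually touching"* — touching blocks have indices at sup-distance ≤ 1). [cite: Dimock2013BalabanII, App. E Lemma E.1(3) (proof, arXiv:1212.5562v2 TeX L6820)] -/
theorem cadj_of_mem_cube {b b' : Pt d} {p : RPt d} (hp : p ∈ cube b) (hp' : p ∈ cube b') (hne : b ≠ b') :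
    CAdj b b' := by
  refine ⟨hne, B13ScaleTransfer.mem_block.2 fun i => ?_⟩
  obtain ⟨h1, h2⟩ := mem_cube.1 hp i
  obtain ⟨h3, h4⟩ := mem_cube.1 hp' i
  have h5 : (b' i : ℝ) ≤ b i + 1 := by linarith
  have h6 : ((b i - 1 : ℤ) : ℝ) ≤ b' i := by
    push_cast
    linarith
  exact ⟨by exact_mod_cast h6, by exact_mod_cast h5⟩

/-- `X̃ = X ∪ (corner-neighbours of X)`: a cube lies in `B13ScaleTransfer.collar Z = ⋃_{z ∈ Z} □̃(z)` ([Balaban1987RG1] p. 257, X̃ = X̃¹)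
iff it is a cube of Z or corner-adjacent to one. [cite: Balaban1987RG1, p.257 (definition of □̃ⁿ)] -/
theorem mem_collar_iff {Z : Finset (Pt d)} {a : Pt d} : a ∈ B13ScaleTransfer.collar Z ↔ a ∈ Z ∨ ∃ b ∈ Z, CAdj a b := by
  rw [B13ScaleTransfer.collar, Finset.mem_biUnion]
  constructor
  · rintro ⟨b, hb, hab⟩
    by_cases h : a = b
    · subst h
      exact Or.inl hb
    · exact Or.inr ⟨b, hb, h, mem_block_comm.1 hab⟩
  · rintro (ha | ⟨b, hb, hab⟩)
    · exact ⟨a, ha, B13ScaleTransfer.mem_block_self a⟩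
    · exact ⟨b, hb, mem_block_comm.1 hab.2⟩

/-- The corner-neighbours of a cube inside the window B. [folklore] -/
def cnbr (B : Finset (Pt d)) (a : Cell B) : Finset (Cell B) := by
  classical
  exact Finset.univ.filter fun b => CAdj a.1 b.1

/-- Membership in `cnbr`. [folklore] -/
@[simp] theorem mem_cnbr {B : Finset (Pt d)} {a b : Cell B} : b ∈ cnbr B a ↔ CAdj a.1 b.1 := by
  classical
  simp [cnbr]

/-- DEGREE BOUND: a cube has at most 3^d − 1 corner-neighbours in the window (they are cubes of □̃(a), which consists
of 3^d cubes, `B13ScaleTransfer.card_block`, minus a itself). [cite: Balaban1987RG1, p.257 (definition of □̃ⁿ)] -/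
theorem card_cnbr_le (B : Finset (Pt d)) (a : Cell B) : (cnbr B a).card ≤ 3 ^ d - 1 := by
  classical
  have hsub : (cnbr B a).map (Function.Embedding.subtype _) ⊆ (B13ScaleTransfer.block a.1).erase a.1 := by
    intro y hy
    rw [Finset.mem_map] at hy
    obtain ⟨b, hb, rfl⟩ := hy
    have h := mem_cnbr.1 hb
    show b.1 ∈ (B13ScaleTransfer.block a.1).erase a.1
    exact Finset.mem_erase.2 ⟨fun e => h.1 e.symm, h.2⟩
  calc (cnbr B a).card = ((cnbr B a).map (Function.Embedding.subtype _)).card := (Finset.card_map _).symm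
    _ ≤ ((B13ScaleTransfer.block a.1).erase a.1).card := Finset.card_le_card hsub
    _ = 3 ^ d - 1 := by rw [Finset.card_erase_of_mem (B13ScaleTransfer.mem_block_self a.1), B13ScaleTransfer.card_block]

/-! ## 2. The relative linear size d_{k,Z}(Y) of (1.67) -/

/-- RELATIVELY ADMISSIBLE GRAPHS — [Balaban1989LargeFieldII] (1.67) p. 376, verbatim: *"a … tree graph contained in Y
and intersecting all M-cubes of the components of Y∖Z"*: the graph is connected, contained in the union of the cubes of
X, and meets every cube of the family S (S = the cubes of Y∖Z in §5; conventions (i)–(ii) of the module header).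
For S = X this is `TreeLength.Admissible X` ([Balaban1987RG1] p. 257). [cite: Balaban1989LargeFieldII, (1.67) p.376] -/
structure RAdmissible (X S : Finset (Pt d)) (T : List (Seg d)) : Prop where
  /-- the graph is connected -/
  connected : IsConnected (carrier T)
  /-- the graph is contained in Y -/
  subset : carrier T ⊆ cubes X
  /-- the graph intersects all the cubes of Y∖Z -/
  meets : ∀ s ∈ S, (carrier T ∩ cube s).Nonempty

/-- The set of lengths of the relatively admissible graphs. [cite: Balaban1989LargeFieldII, (1.67) p.376] -/
def rlengths (X S : Finset (Pt d)) : Set ℝ := {ℓ | ∃ T, RAdmissible X S T ∧ len T = ℓ}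

/-- THE RELATIVE LINEAR SIZE d_{k,Z}(Y) — [Balaban1989LargeFieldII] (1.67) p. 376, verbatim: *"d_{k,Z}(Y) = M⁻¹ (the
length of a shortest tree graph contained in Y and intersecting all M-cubes of the components of Y∖Z)"* — as the
infimum of the lengths of the relatively admissible graphs (unit cubes, so no division by M; junk value `sInf ∅ = 0`
on an empty class; S = the cubes of Y∖Z). [cite: Balaban1989LargeFieldII, (1.67) p.376] -/
def relTreeLen (X S : Finset (Pt d)) : ℝ := sInf (rlengths X S)

/-- Members of `rlengths` are non-negative. [folklore] -/
theorem rlengths_nonneg {X S : Finset (Pt d)} {ℓ : ℝ} (h : ℓ ∈ rlengths X S) : 0 ≤ ℓ := by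
  obtain ⟨T, -, rfl⟩ := h
  exact len_nonneg T

/-- `rlengths` is bounded below (by 0). [folklore] -/
theorem bddBelow_rlengths (X S : Finset (Pt d)) : BddBelow (rlengths X S) :=
  ⟨0, fun _ h => rlengths_nonneg h⟩

/-- d_{k,Z}(Y) ≥ 0. [cite: Balaban1989LargeFieldII, (1.67) p.376] -/
theorem relTreeLen_nonneg (X S : Finset (Pt d)) : 0 ≤ relTreeLen X S :=
  Real.sInf_nonneg fun _ h => rlengths_nonneg h

/-- d_{k,Z}(Y) is at most the length of any relatively admissible graph. [cite: Balaban1989LargeFieldII, (1.67) p.376] -/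
theorem relTreeLen_le_len {X S : Finset (Pt d)} {T : List (Seg d)} (h : RAdmissible X S T) :
    relTreeLen X S ≤ len T :=
  csInf_le (bddBelow_rlengths X S) ⟨T, h, rfl⟩

/-- A lower bound of the lengths of all relatively admissible graphs bounds d_{k,Z}(Y) from below, provided the class
is non-empty. [folklore] -/
theorem le_relTreeLen {X S : Finset (Pt d)} {a : ℝ} (hne : ∃ T, RAdmissible X S T)
    (h : ∀ T, RAdmissible X S T → a ≤ len T) : a ≤ relTreeLen X S := by
  obtain ⟨T₀, hT₀⟩ := hne
  refine le_csInf ⟨len T₀, T₀, hT₀, rfl⟩ ?_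
  rintro _ ⟨T, hT, rfl⟩
  exact h T hT

/-- An admissible graph for X ([Balaban1987RG1] p. 257) is relatively admissible for every S ⊆ X (*"a tree meeting all
cubes of X meets those of X∖Z"*, the remark behind `B16.RelDomainSys.dRel_le`). [cite: Balaban1989LargeFieldII, (1.67) p.376] -/
theorem rAdmissible_of_admissible {X S : Finset (Pt d)} {T : List (Seg d)} (h : Admissible X T) (hS : S ⊆ X) :
    RAdmissible X S T :=
  ⟨h.connected, h.subset, fun s hs => h.meets s (hS hs)⟩

/-- For S = X relative admissibility is admissibility. [folklore] -/
theorem rAdmissible_self_iff {X : Finset (Pt d)} {T : List (Seg d)} : RAdmissible X X T ↔ Admissible X T :=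
  ⟨fun h => ⟨h.connected, h.subset, h.meets⟩, fun h => rAdmissible_of_admissible h (Finset.Subset.refl X)⟩

/-- For S = X the relative length set is the length set of `treeLen`. [folklore] -/
theorem rlengths_self (X : Finset (Pt d)) : rlengths X X = lengths X := by
  ext ℓ
  simp only [rlengths, lengths, Set.mem_setOf_eq, rAdmissible_self_iff]

/-- d_{k,Z}(Y) = d_k(Y) when every cube of Y counts (Y∖Z = Y): the clause `dRel_eq_of_not_meets` of
`B16.RelDomainSys`, here a theorem of the model. [cite: Balaban1989LargeFieldII, (1.67) p.376] -/
theorem relTreeLen_self (X : Finset (Pt d)) : relTreeLen X X = treeLen X := by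
  rw [relTreeLen, treeLen, rlengths_self]

/-- The admissible lengths are relative lengths, for S ⊆ X. [folklore] -/
theorem lengths_subset_rlengths {X S : Finset (Pt d)} (hS : S ⊆ X) : lengths X ⊆ rlengths X S := by
  rintro _ ⟨T, hT, rfl⟩
  exact ⟨T, rAdmissible_of_admissible hT hS, rfl⟩

/-- `0 ≤ d_{k,Z}(Y) ≤ d_k(Y)` (the clause `dRel_le` of `B16.RelDomainSys`), for S ⊆ X and X with an admissible graph.
[cite: Balaban1989LargeFieldII, (1.67) p.376] -/
theorem relTreeLen_le_treeLen {X S : Finset (Pt d)} (hS : S ⊆ X) (hne : ∃ T, Admissible X T) :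
    relTreeLen X S ≤ treeLen X := by
  obtain ⟨T, hT⟩ := hne
  exact csInf_le_csInf (bddBelow_rlengths X S) ⟨len T, T, hT, rfl⟩ (lengths_subset_rlengths hS)

/-- A localization domain (non-empty, common-wall connected) has a relatively admissible graph for every S ⊆ X (pv22's
`TreeLength.exists_admissible`). [folklore] -/
theorem exists_rAdmissible {X S : Finset (Pt d)} (hX : X.Nonempty) (hc : FaceConnected X) (hS : S ⊆ X) :
    ∃ T, RAdmissible X S T := by
  obtain ⟨T, hT, -⟩ := exists_admissible hX hc
  exact ⟨T, rAdmissible_of_admissible hT hS⟩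

/-! ## 3. The cubes met by a graph: Steiner-admissible, corner-connected -/

/-- THE MET FAMILY: the cubes of X meeting the graph T (the family "A = the M-cubes of X met by an optimal tree τ of
(1.67)" of `B14.RelAnimal.RelCubeSystem.RelAnimalLeaf`'s docstring, for an arbitrary graph). [folklore] -/
def met (X : Finset (Pt d)) (T : List (Seg d)) : Finset (Pt d) := by
  classical
  exact X.filter fun x => (carrier T ∩ cube x).Nonempty

/-- Membership in the met family. [folklore] -/
theorem mem_met {X : Finset (Pt d)} {T : List (Seg d)} {x : Pt d} :
    x ∈ met X T ↔ x ∈ X ∧ (carrier T ∩ cube x).Nonempty := by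
  classical
  unfold met
  rw [Finset.mem_filter]

/-- The met family consists of cubes of X. [folklore] -/
theorem met_subset (X : Finset (Pt d)) (T : List (Seg d)) : met X T ⊆ X :=
  fun _ h => (mem_met.1 h).1

/-- A family of cubes of X all met by T lies in the met family. [folklore] -/
theorem subset_met {X S : Finset (Pt d)} {T : List (Seg d)} (hS : S ⊆ X)
    (h : ∀ s ∈ S, (carrier T ∩ cube s).Nonempty) : S ⊆ met X T :=
  fun s hs => mem_met.2 ⟨hS hs, h s hs⟩

/-- A connected graph is Steiner-admissible (`TreeLength.SAdmissible`, [Dimock2013BalabanII] App. E: *"one point from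
each block in Y and possibly other points"*) for its met family. [cite: Dimock2013BalabanII, App. E (preamble of Lemma E.1)] -/
theorem sAdmissible_met {X : Finset (Pt d)} {T : List (Seg d)} (hT : IsConnected (carrier T)) :
    SAdmissible (met X T) T :=
  ⟨hT, fun _ hy => (mem_met.1 hy).2⟩

/-- THE VOLUME OF THE MET FAMILY: `#met X T ≤ 2^d(4|T| + 1)` — pv22's `card_le_of_sAdmissible_len` ([Dimock2013BalabanII]
App. E Lemma E.1 (3) mechanism, *"|Y|_M ≤ 4(2^d+1)(ℓ_M(Y)+1)"*). [cite: Dimock2013BalabanII, App. E Lemma E.1(3)] -/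
theorem card_met_le {X : Finset (Pt d)} {T : List (Seg d)} (hT : IsConnected (carrier T)) :
    ((met X T).card : ℝ) ≤ 2 ^ d * (4 * len T + 1) :=
  card_le_of_sAdmissible_len (sAdmissible_met hT)

/-- A graph inside the cubes of X lies inside the cubes of its met family. [folklore] -/
theorem carrier_subset_cubes_met {X : Finset (Pt d)} {T : List (Seg d)} (hsub : carrier T ⊆ cubes X) :
    carrier T ⊆ cubes (met X T) := by
  intro p hp
  obtain ⟨x, hx, hpx⟩ := mem_cubes.1 (hsub hp)
  exact mem_cubes.2 ⟨x, mem_met.2 ⟨hx, p, hp, hpx⟩, hpx⟩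

/-- Cubes are closed. [folklore] -/
theorem isClosed_cube (x : Pt d) : IsClosed (cube x) := isClosed_Icc

/-- THE MET FAMILY IS CORNER-CONNECTED (chain form): any two cubes of X met by a preconnected graph T ⊂ cubes(X) are
joined by a chain of corner-adjacent met cubes.  Proof: the closed sets ⋃_{b ∈ C} □_b (C = the corner-component of v in
the met family) and ⋃_{b ∈ met∖C} □_b cover the carrier; if w ∉ C both meet it, so by `isPreconnected_closed_iff` a
point of the carrier lies in □_b ∩ □_{b′} with b ∈ C, b′ ∉ C, and `cadj_of_mem_cube` puts b′ in C. (Docstring (iii) of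
`B14.RelAnimal.RelCubeSystem`: *"the M-cubes met by a continuum tree form an Adj-connected family"*.) [folklore] -/
theorem met_chain {X : Finset (Pt d)} {T : List (Seg d)} (hT : IsPreconnected (carrier T))
    (hsub : carrier T ⊆ cubes X) {v w : Pt d} (hv : v ∈ met X T) (hw : w ∈ met X T) :
    Relation.ReflTransGen (fun x y => CAdj x y ∧ x ∈ met X T ∧ y ∈ met X T) v w := by
  classical
  set M := met X T with hM
  set C := rcomponent CAdj M v with hC
  suffices h : w ∈ C from (mem_rcomponent.1 h).2
  by_contra hwC
  set t : Set (RPt d) := ⋃ b ∈ C, cube b with ht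
  set t' : Set (RPt d) := ⋃ b ∈ M \ C, cube b with ht'
  have htc : IsClosed t := isClosed_biUnion_finset fun b _ => isClosed_cube b
  have htc' : IsClosed t' := isClosed_biUnion_finset fun b _ => isClosed_cube b
  have hcover : carrier T ⊆ t ∪ t' := by
    intro p hp
    obtain ⟨x, hx, hpx⟩ := mem_cubes.1 (hsub hp)
    have hxM : x ∈ M := mem_met.2 ⟨hx, p, hp, hpx⟩
    by_cases hxC : x ∈ C
    · exact Or.inl (Set.mem_iUnion₂.2 ⟨x, hxC, hpx⟩)
    · exact Or.inr (Set.mem_iUnion₂.2 ⟨x, Finset.mem_sdiff.2 ⟨hxM, hxC⟩, hpx⟩)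
  have hne1 : (carrier T ∩ t).Nonempty := by
    obtain ⟨p, hp, hpv⟩ := (mem_met.1 hv).2
    exact ⟨p, hp, Set.mem_iUnion₂.2 ⟨v, mem_rcomponent_self hv, hpv⟩⟩
  have hne2 : (carrier T ∩ t').Nonempty := by
    obtain ⟨p, hp, hpw⟩ := (mem_met.1 hw).2
    exact ⟨p, hp, Set.mem_iUnion₂.2 ⟨w, Finset.mem_sdiff.2 ⟨hw, hwC⟩, hpw⟩⟩
  obtain ⟨p, -, hpt, hpt'⟩ := isPreconnected_closed_iff.1 hT t t' htc htc' hcover hne1 hne2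
  obtain ⟨b, hbC, hpb⟩ := Set.mem_iUnion₂.1 hpt
  obtain ⟨b', hb'MC, hpb'⟩ := Set.mem_iUnion₂.1 hpt'
  obtain ⟨hb'M, hb'C⟩ := Finset.mem_sdiff.1 hb'MC
  have hne : b ≠ b' := fun h => hb'C (h ▸ hbC)
  have hadj : CAdj b b' := cadj_of_mem_cube hpb hpb' hne
  exact hb'C (mem_rcomponent.2
    ⟨hb'M, (mem_rcomponent.1 hbC).2.tail ⟨hadj, rcomponent_subset _ _ hbC, hb'M⟩⟩)

/-- THE MET FAMILY IS CORNER-CONNECTED: for a connected graph inside the cubes of X, `met X T` is a non-empty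
corner-connected family (`IsRConnected CAdj`). [folklore] -/
theorem isRConnected_met {X : Finset (Pt d)} {T : List (Seg d)} (hT : IsConnected (carrier T))
    (hsub : carrier T ⊆ cubes X) : IsRConnected CAdj (met X T) := by
  obtain ⟨p, hp⟩ := hT.nonempty
  obtain ⟨x, hx, hpx⟩ := mem_cubes.1 (hsub hp)
  exact ⟨⟨x, mem_met.2 ⟨hx, p, hp, hpx⟩⟩, fun v hv w hw => met_chain hT.isPreconnected hsub hv hw⟩

/-! ## 4. The relative Steiner animal -/

/-- **THE RELATIVE ANIMAL** (the content of `B14.RelAnimal.RelCubeSystem.RelAnimalLeaf`, on the continuum model): if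
S ⊆ X and the relative class is non-empty, there is a corner-connected family A of cubes with `S ⊆ A ⊆ X` and
`#A ≤ 2^d(4·d_{k,Z} + 1)` where `d_{k,Z} = relTreeLen X S`.  A = the met family of a graph of the class meeting the
FEWEST cubes of X (`Nat.sInf_mem`); for every graph T of the class `#A ≤ #met X T ≤ 2^d(4|T|+1)` (`card_met_le`), and
the infimum over T is taken with `le_relTreeLen` — [Dimock2013BalabanII] App. E Lemma E.1 (3) *"|Y|_M ≤
4(2^d+1)(ℓ_M(Y)+1)"* with L6788 *"ℓ̃_M(Y) ≤ d_M(Y)"*, in the relative setting. [cite: Dimock2013BalabanII, App. E Lemma E.1(3)] -/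
theorem exists_relAnimal {X S : Finset (Pt d)} (hSX : S ⊆ X) (hne : ∃ T, RAdmissible X S T) :
    ∃ A : Finset (Pt d), S ⊆ A ∧ A ⊆ X ∧ IsRConnected CAdj A ∧
      (A.card : ℝ) ≤ 2 ^ d * (4 * relTreeLen X S + 1) := by
  classical
  set N : Set ℕ := {n | ∃ T, RAdmissible X S T ∧ (met X T).card = n} with hN
  have hNne : N.Nonempty := by
    obtain ⟨T, hT⟩ := hne
    exact ⟨_, T, hT, rfl⟩
  obtain ⟨T₀, hT₀, hcard⟩ := Nat.sInf_mem hNne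
  refine ⟨met X T₀, subset_met hSX hT₀.meets, met_subset X T₀, isRConnected_met hT₀.connected hT₀.subset, ?_⟩
  have h2d : (0 : ℝ) < 2 ^ d := by positivity
  have hmin : ∀ T, RAdmissible X S T → ((met X T₀).card : ℝ) ≤ 2 ^ d * (4 * len T + 1) := by
    intro T hT
    have h1 : (met X T₀).card ≤ (met X T).card := by
      rw [hcard]
      exact Nat.sInf_le ⟨T, hT, rfl⟩
    exact (Nat.cast_le.2 h1).trans (card_met_le hT.connected)
  have h : (((met X T₀).card : ℝ) / 2 ^ d - 1) / 4 ≤ relTreeLen X S := by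
    refine le_relTreeLen hne fun T hT => ?_
    have := hmin T hT
    rw [div_le_iff₀ (by norm_num : (0 : ℝ) < 4), sub_le_iff_le_add, div_le_iff₀ h2d]
    linarith
  rw [div_le_iff₀ (by norm_num : (0 : ℝ) < 4), sub_le_iff_le_add, div_le_iff₀ h2d] at h
  linarith

/-- Transport: an `R`-chain inside a family A ⊆ B of cubes is a chain of cells of the window B inside `cellsOf B A`
(pv22's `TreeLengthCubeSystem.linked_lift` for a general relation). [folklore] -/
theorem chain_lift {B A : Finset (Pt d)} (hAB : A ⊆ B) {R : Pt d → Pt d → Prop} {x y : Pt d} (hx : x ∈ B)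
    (h : Relation.ReflTransGen (fun a b => R a b ∧ a ∈ A ∧ b ∈ A) x y) :
    ∀ hy : y ∈ B, Relation.ReflTransGen
      (fun a b : Cell B => R a.1 b.1 ∧ a ∈ cellsOf B A ∧ b ∈ cellsOf B A) ⟨x, hx⟩ ⟨y, hy⟩ := by
  induction h with
  | refl => intro hy; exact Relation.ReflTransGen.refl
  | tail _ hbc ih =>
    intro hy
    obtain ⟨hR, hb, hc⟩ := hbc
    exact Relation.ReflTransGen.tail (ih (hAB hb)) ⟨hR, mem_cellsOf.2 hb, mem_cellsOf.2 hc⟩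

/-- Transport of `IsRConnected` from families of cubes of ℤ^d to families of cells of a window. [folklore] -/
theorem isRConnected_cellsOf_of {B A : Finset (Pt d)} (hAB : A ⊆ B) {R : Pt d → Pt d → Prop}
    (hA : IsRConnected R A) : IsRConnected (fun a b : Cell B => R a.1 b.1) (cellsOf B A) := by
  obtain ⟨⟨x, hx⟩, hconn⟩ := hA
  refine ⟨⟨⟨x, hAB hx⟩, mem_cellsOf.2 hx⟩, fun v hv w hw => ?_⟩
  exact chain_lift hAB v.2 (hconn v.1 (mem_cellsOf.1 hv) w.1 (mem_cellsOf.1 hw)) w.2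

/-- `IsRConnected` is monotone in the relation. [folklore] -/
theorem isRConnected_mono {V : Type*} [DecidableEq V] {R R' : V → V → Prop} (h : ∀ x y, R x y → R' x y)
    {A : Finset V} (hA : IsRConnected R A) : IsRConnected R' A := by
  refine ⟨hA.1, fun v hv w hw => ?_⟩
  have h0 := hA.2 v hv w hw
  clear hw
  induction h0 with
  | refl => exact Relation.ReflTransGen.refl
  | tail _ hbc ih => exact ih.tail ⟨h _ _ hbc.1, hbc.2.1, hbc.2.2⟩

/-- `cellsOf B` is monotone. [folklore] -/
theorem cellsOf_mono {B X Y : Finset (Pt d)} (h : X ⊆ Y) : cellsOf B X ⊆ cellsOf B Y :=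
  fun _ hc => mem_cellsOf.2 (h (mem_cellsOf.1 hc))

/-- `cellsOf B` commutes with set difference. [folklore] -/
theorem cellsOf_sdiff (B X Y : Finset (Pt d)) : cellsOf B (X \ Y) = cellsOf B X \ cellsOf B Y := by
  ext c
  simp only [mem_cellsOf, Finset.mem_sdiff]

/-! ## 5. The concrete carrier of one scale: a window of ℤ^d with Ω_j ⊇ Λ_j ⊇ Λ_j^0 -/

/-- THE DATA OF ONE SCALE j of [Balaban1988Convergent] §2 inside a finite window `B` of cubes of ℤ^d (rescaled M-cubes
of `T_{L^{−j}}`): the families of cubes of `Ω_j ⊇ Λ_j ⊇ Λ_j^0` ((2.1) p. 254, p. 259) with the located LAYER property of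
p. 259 *"Λ_j^0 the set which is obtained by removing one layer of the MR_j-cubes from Λ_j^{(j)}"* (R_j ≥ 1: every cube of
the window corner-adjacent to a cube of Λ_j^0 is a cube of Λ_j).  `Z_j = Λ_j^c` ((2.3) p. 255) is `Window.Z := B∖Λ_j`.
Convention (iii) of the module header (a window of ℤ^d instead of the torus). [cite: Balaban1988Convergent, (2.1) p.254, (2.3) p.255, p.259] -/
structure Window (d : ℕ) where
  /-- the cubes of the window -/
  B : Finset (Pt d)
  /-- the cubes of `Ω_j` -/
  Omega : Finset (Pt d)
  /-- the cubes of `Λ_j` -/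
  Lam : Finset (Pt d)
  /-- the cubes of `Λ_j^0` -/
  Lam0 : Finset (Pt d)
  /-- the window contains `Ω_j` -/
  omega_subset : Omega ⊆ B
  /-- (2.1): `Λ_j ⊂ Ω_j` -/
  lam_subset_omega : Lam ⊆ Omega
  /-- p. 259: `Λ_j^0 ⊂ Λ_j` -/
  lam0_subset_lam : Lam0 ⊆ Lam
  /-- p. 259: one layer was removed -/
  layer : ∀ a ∈ Lam0, ∀ b ∈ B, CAdj a b → b ∈ Lam

namespace Window

variable (W : Window d)

/-- (2.3) p. 255 *"Z_j = Λ_j^c"* inside the window: the cubes of B not in Λ_j. [cite: Balaban1988Convergent, (2.3) p.255] -/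
def Z : Finset (Pt d) := W.B \ W.Lam

/-- Membership in `Z_j`. [folklore] -/
theorem mem_Z {a : Pt d} : a ∈ W.Z ↔ a ∈ W.B ∧ a ∉ W.Lam := Finset.mem_sdiff

/-- THE ADMISSIBILITY PREDICATE of the resummed (2.41) of [Balaban1988Convergent] p. 262: X *"either contains a component
of the large field region Z_j, or is disjoint with it"* (closure form: a cube of Z_j corner-adjacent to a Z_j-cube of X
is a cube of X), (2.41) p. 261 *"X∩Ω_j ≠ ∅, and X∩Z_j^~ ≠ ∅"* (Z̃ = `B13ScaleTransfer.collar Z`, [I] p. 257). [cite: Balaban1988Convergent, (2.41) p.261, p.262] -/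
def IsAdm (X : Finset (Pt d)) : Prop :=
  (∀ a ∈ X, a ∈ W.Z → ∀ b ∈ W.Z, CAdj a b → b ∈ X) ∧ (X ∩ W.Omega).Nonempty ∧ (X ∩ B13ScaleTransfer.collar W.Z).Nonempty

/-- The index set of the resummed (2.41): the localization domains of the window satisfying `IsAdm`. [cite: Balaban1988Convergent, (2.41) p.261, p.262] -/
def admSet : Finset (Dom W.B) := by
  classical
  exact Finset.univ.filter fun X => W.IsAdm X.1

/-- Membership in `admSet`. [folklore] -/
theorem mem_admSet {X : Dom W.B} : X ∈ W.admSet ↔ W.IsAdm X.1 := by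
  classical
  simp [admSet]

/-- **THE CONCRETE `B16.RelDomainSys` OF A WINDOW**: pv22's `TreeLengthCubeSystem.sys B` (domains = non-empty common-wall
connected families X ⊆ B, `d_j = treeLen`) EXTENDED by the relative size (1.67) `dRel X := relTreeLen X (X∖Z_j)` and
`MeetsLF X := X ∩ Z_j ≠ ∅`; the three clauses of unit b02's structure (`0 ≤ d_{j,Z_j} ≤ d_j`, `d_{j,Z_j}(X) = d_j(X)` for
X ∩ Z_j = ∅) are THEOREMS here (`relTreeLen_nonneg`, `relTreeLen_le_treeLen`, `relTreeLen_self`). [cite: Balaban1989LargeFieldII, (1.67) p.376] -/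
def relSys : B16.RelDomainSys where
  toLocDomainSys := TreeLengthCubeSystem.sys W.B
  dRel := fun X => relTreeLen X.1 (X.1 \ W.Z)
  MeetsLF := fun X => (X.1 ∩ W.Z).Nonempty
  dRel_nonneg := fun X => relTreeLen_nonneg X.1 _
  dRel_le := fun X =>
    relTreeLen_le_treeLen Finset.sdiff_subset
      (let ⟨T, hT, _⟩ := exists_admissible X.2.2.1 X.2.2.2; ⟨T, hT⟩)
  dRel_eq_of_not_meets := fun X h => by
    have hX : X.1 \ W.Z = X.1 := by
      rw [Finset.sdiff_eq_self_iff_disjoint]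
      exact Finset.disjoint_iff_inter_eq_empty.2 (Finset.not_nonempty_iff_eq_empty.1 h)
    show relTreeLen X.1 (X.1 \ W.Z) = treeLen X.1
    rw [hX, relTreeLen_self]

/-- The domains of `relSys` are pv22's `Dom B`. [folklore] -/
theorem relSys_Dom : W.relSys.Dom = Dom W.B := rfl

/-- The relative size of `relSys` is `relTreeLen X (X∖Z_j)`. [folklore] -/
@[simp] theorem relSys_dRel (X : W.relSys.Dom) : W.relSys.dRel X = relTreeLen X.1 (X.1 \ W.Z) := rfl

/-- The full size of `relSys` is `treeLen`. [folklore] -/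
@[simp] theorem relSys_dj (X : W.relSys.Dom) : W.relSys.dj X = treeLen X.1 := rfl

/-- **THE CONCRETE `B14.RelAnimal.RelCubeSystem` OF A WINDOW** over `relSys`: cubes = `Cell B`, `Adj` = CORNER adjacency
(docstring (i)–(iv) of gen 3's structure), neighbour lists `cnbr`, cubes of a domain = its members (corner-connected
since common-wall connected), `Omega`/`Lam`/`Lam0`/`Z` = the cells of `Ω_j`/`Λ_j`/`Λ_j^0`/`Z_j`, `adm` = `admSet`; the
located facts (2.1), p. 259 (`layer`), (2.3) (`mem_Z_iff`), p. 262 (`glued`), (2.41) (`meets_omega`, `meets_Ztilde`) are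
all PROVED from the window data. [cite: Balaban1988Convergent, (2.41) p.261, p.262] -/
def relCubeSys : B14.RelAnimal.RelCubeSystem W.relSys where
  Cube := Cell W.B
  Adj := fun a b => CAdj a.1 b.1
  adj_symm := fun _ _ h => h.symm
  nbr := cnbr W.B
  mem_nbr := fun _ _ h => mem_cnbr.2 h
  cubes := fun X => cellsOf W.B X.1
  cubes_injective := fun X Y h => Subtype.ext (cellsOf_inj X.2.1 Y.2.1 h)
  connected := fun X =>
    isRConnected_mono (fun _ _ h => cadj_of_adj h) (isRConnected_cellsOf X)
  Omega := cellsOf W.B W.Omega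
  Lam := cellsOf W.B W.Lam
  Lam0 := cellsOf W.B W.Lam0
  Z := cellsOf W.B W.Z
  lam_subset_omega := cellsOf_mono W.lam_subset_omega
  lam0_subset_lam := cellsOf_mono W.lam0_subset_lam
  layer := fun a ha b hab => mem_cellsOf.2 (W.layer a.1 (mem_cellsOf.1 ha) b.1 b.2 hab)
  mem_Z_iff := fun a => by
    rw [mem_cellsOf, mem_cellsOf, mem_Z]
    exact ⟨fun h => h.2, fun h => ⟨a.2, h⟩⟩
  adm := W.admSet
  glued := fun X hX a ha haZ b hbZ hab =>
    mem_cellsOf.2 ((W.mem_admSet.1 hX).1 a.1 (mem_cellsOf.1 ha) (mem_cellsOf.1 haZ) b.1 (mem_cellsOf.1 hbZ) hab)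
  meets_omega := fun X hX => by
    obtain ⟨x, hx⟩ := (W.mem_admSet.1 hX).2.1
    rw [Finset.mem_inter] at hx
    exact ⟨⟨x, W.omega_subset hx.2⟩, mem_cellsOf.2 hx.1, mem_cellsOf.2 hx.2⟩
  meets_Ztilde := fun X hX => by
    obtain ⟨x, hx⟩ := (W.mem_admSet.1 hX).2.2
    rw [Finset.mem_inter] at hx
    obtain ⟨hxX, hxc⟩ := hx
    have hxB : x ∈ W.B := X.2.1 hxX
    rcases mem_collar_iff.1 hxc with hxZ | ⟨b, hbZ, hxb⟩
    · exact ⟨⟨x, hxB⟩, mem_cellsOf.2 hxX, Or.inl (mem_cellsOf.2 hxZ)⟩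
    · exact ⟨⟨x, hxB⟩, mem_cellsOf.2 hxX, Or.inr ⟨⟨b, (W.mem_Z.1 hbZ).1⟩, mem_cellsOf.2 hbZ, hxb⟩⟩

/-- The cubes of a domain in the concrete system are its members. [folklore] -/
@[simp] theorem relCubeSys_cubes (X : W.relSys.Dom) : W.relCubeSys.cubes X = cellsOf W.B X.1 := rfl

/-- The large-field cells of the concrete system. [folklore] -/
@[simp] theorem relCubeSys_Z : W.relCubeSys.Z = cellsOf W.B W.Z := rfl

/-- The `Ω_j`-cells of the concrete system. [folklore] -/
@[simp] theorem relCubeSys_Omega : W.relCubeSys.Omega = cellsOf W.B W.Omega := rfl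

/-- The `Λ_j^0`-cells of the concrete system. [folklore] -/
@[simp] theorem relCubeSys_Lam0 : W.relCubeSys.Lam0 = cellsOf W.B W.Lam0 := rfl

/-- The admissible set of the concrete system is `admSet`. [folklore] -/
@[simp] theorem relCubeSys_adm : W.relCubeSys.adm = W.admSet := rfl

/-- Membership in the resummed class of the concrete system. [cite: Balaban1988Convergent, (2.41) p.261, p.262] -/
theorem mem_adm {X : W.relSys.Dom} : X ∈ W.relCubeSys.adm ↔ W.IsAdm X.1 := W.mem_admSet

/-- The small-field part `S(X) = X∖Z_j` of a domain in the concrete system: a cell is small iff its cube is a cube of X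
not in Z_j. [cite: Balaban1988Convergent, p.262] -/
theorem mem_small_iff {X : W.relSys.Dom} {a : Cell W.B} :
    a ∈ (W.relCubeSys.small X : Finset (Cell W.B)) ↔ a.1 ∈ X.1 ∧ a.1 ∉ W.Z := by
  show a ∈ cellsOf W.B X.1 \ cellsOf W.B W.Z ↔ _
  rw [Finset.mem_sdiff, mem_cellsOf, mem_cellsOf]

/-! ## 6. The leaf, Lemma E.3 and the per-scale bound of (2.48), unconditional on the concrete carrier -/

/-- DEGREE BOUND of the concrete system: Δ = 3^d − 1 corner-neighbours (`card_cnbr_le`; 3^d − 1 in ℕ, no truncation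
since 3^d ≥ 1). [cite: Balaban1987RG1, p.257 (definition of □̃ⁿ)] -/
theorem degreeLE : W.relCubeSys.DegreeLE (3 ^ d - 1) := by
  intro a
  exact card_cnbr_le W.B a

/-- **THE RELATIVE STEINER-ANIMAL LEAF, PROVED** on the concrete carrier with `c₀ = 4·2^d` (= 64 for d = 4): every
domain X of the window with `X∖Z_j ≠ ∅` contains a corner-connected family A of cells with `S(X) ⊆ A ⊆ X` and `#A ≤
4·2^d(1 + d_{j,Z_j}(X))` (`exists_relAnimal` with S = X∖Z_j, transported to cells; `2^d(4r+1) ≤ 4·2^d(1+r)`).  This is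
gen 3's quoted leaf `B14.RelAnimal.RelCubeSystem.RelAnimalLeaf` ([Dimock2013BalabanII] App. E Lemma E.1 in the relative
setting) as a THEOREM of the model. [cite: Dimock2013BalabanII, App. E Lemma E.1(3)] -/
theorem relAnimalLeaf : W.relCubeSys.RelAnimalLeaf (4 * 2 ^ d) := by
  intro X hne
  set Sm := X.1 \ W.Z with hSm
  have hSX : Sm ⊆ X.1 := Finset.sdiff_subset
  have hadm : ∃ T, RAdmissible X.1 Sm T := exists_rAdmissible X.2.2.1 X.2.2.2 hSX
  obtain ⟨A, hSA, hAX, hconn, hcard⟩ := exists_relAnimal hSX hadm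
  have hAB : A ⊆ W.B := hAX.trans X.2.1
  refine ⟨cellsOf W.B A, ?_, ?_, isRConnected_cellsOf_of hAB hconn, ?_⟩
  · intro a ha
    exact mem_cellsOf.2 (hSA (Finset.mem_sdiff.2 (W.mem_small_iff.1 ha)))
  · intro a ha
    rw [relCubeSys_cubes]
    exact mem_cellsOf.2 (hAX (mem_cellsOf.1 ha))
  · have hc : ((cellsOf W.B A).card : ℝ) = A.card := by rw [card_cellsOf hAB]
    show ((cellsOf W.B A).card : ℝ) ≤ 4 * 2 ^ d * (1 + relTreeLen X.1 (X.1 \ W.Z))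
    rw [hc]
    have h2d : (0 : ℝ) ≤ 2 ^ d := by positivity
    have hr := relTreeLen_nonneg X.1 (X.1 \ W.Z)
    nlinarith [hcard, h2d, hr]

/-- `c₀ = 4·2^d ≥ 0`. [folklore] -/
theorem c₀_nonneg : (0 : ℝ) ≤ 4 * 2 ^ d := by positivity

/-- **LEMMA E.3 OF [Dimock2013BalabanII] FOR THE RELATIVE SIZE (1.67) ON ℤ^d WINDOWS, UNCONDITIONAL** (gen 3's
`relTreeBound` with its two hypotheses discharged): for `κ ≥ RelAnimal.kapparel(4·2^d, 3^d−1)` and every cell □,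
`Σ_{X ∈ adm, □ ∈ S(X)} exp(−κ·d_{j,Z_j}(X)) ≤ RelAnimal.Krel(4·2^d, 3^d−1)`.  Printed (L6914–6920): *"For □ ⊂ Ω and constants κ₀,
K₀ = 𝒪(1):  Σ_{X ∈ 𝒟_k(mod Ω^c), X ⊃ □} exp(−κ₀ d_M(X, mod Ω^c)) ≤ K₀"*. [cite: Dimock2013BalabanII, App. E Lemma E.3 (arXiv:1212.5562v2 TeX L6914-6920)] -/
theorem relTreeBound {κ : ℝ} (hκ : RelAnimal.kapparel (4 * 2 ^ d) (3 ^ d - 1) ≤ κ) (c : Cell W.B) :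
    ∑ X ∈ W.relCubeSys.adm.filter (fun X => c ∈ W.relCubeSys.small X),
      Real.exp (-κ * relTreeLen X.1 (X.1 \ W.Z)) ≤ RelAnimal.Krel (4 * 2 ^ d) (3 ^ d - 1) :=
  W.relCubeSys.relTreeBound W.degreeLE W.relAnimalLeaf hκ c

/-- Lemma E.3 in its printed shape `X ⊃ □`, `□ ⊂ Ω` (□ a small-field cube), unconditional on the concrete carrier.
[cite: Dimock2013BalabanII, App. E Lemma E.3 (arXiv:1212.5562v2 TeX L6914-6920)] -/
theorem sumsum {κ : ℝ} (hκ : RelAnimal.kapparel (4 * 2 ^ d) (3 ^ d - 1) ≤ κ) (c : Cell W.B) (hc : c.1 ∉ W.Z) :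
    ∑ X ∈ W.relCubeSys.adm.filter (fun X => c ∈ cellsOf W.B X.1),
      Real.exp (-κ * relTreeLen X.1 (X.1 \ W.Z)) ≤ RelAnimal.Krel (4 * 2 ^ d) (3 ^ d - 1) :=
  W.relCubeSys.sumsum W.degreeLE W.relAnimalLeaf hκ c fun h => hc (mem_cellsOf.1 h)

/-- **HYPOTHESIS H4 OF GEN 2's `B14.RelBoundary` (the relative anchored tree-graph bound) DISCHARGED** on the concrete
carrier: `RelAnchoredBound relSys ringAnchor κ (RelAnimal.Krel + 1)` for `κ ≥ RelAnimal.kapparel(4·2^d, 3^d−1)`. [cite: Dimock2013BalabanII, App. E Lemma E.3 (arXiv:1212.5562v2 TeX L6914-6966)] -/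
theorem relAnchoredBound {κ : ℝ} (hκ : RelAnimal.kapparel (4 * 2 ^ d) (3 ^ d - 1) ≤ κ) :
    B14.RelBoundary.RelAnchoredBound W.relSys W.relCubeSys.ringAnchor κ (RelAnimal.Krel (4 * 2 ^ d) (3 ^ d - 1) + 1) :=
  W.relCubeSys.relAnchoredBound W.degreeLE c₀_nonneg W.relAnimalLeaf hκ

/-- **THE PER-SCALE INPUT OF [Balaban1988Convergent] (2.48) ON THE CONCRETE CARRIER, UNCONDITIONAL IN THE GEOMETRY**
(gen 3's `scaleBound_Gamma` with degree bound and leaf discharged): if the resummed boundary terms of scale j satisfy,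
at one configuration, *"(2.42) with d_j(X) replaced by d_j(X∖Z_j)"* (p. 262) — `‖B X‖ ≤ B₀exp(−κ·d_{j,Z_j}(X))` on
`adm`, `κ ≥ RelAnimal.kapparel(4·2^d, 3^d−1)` — and `Ω_{j+1} ⊆ Λ_j^0` ((3.5) p. 265 with (2.9)), then `‖Σ_{X∈adm} B X‖ ≤
B₀·(RelAnimal.Krel + 1)·#(Ω_j∖Ω_{j+1})`, i.e. `B₁ = B₀(RelAnimal.Krel+1)M^{−d}` in (2.47)–(2.48) and no factor `2^{−(j−n)}`. [cite: Balaban1988Convergent, (2.47)-(2.48) pp.263-264] -/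
theorem scaleBound_Gamma {κ : ℝ} (hκ : RelAnimal.kapparel (4 * 2 ^ d) (3 ^ d - 1) ≤ κ) (OmegaNext : Finset (Pt d))
    (h35 : OmegaNext ⊆ W.Lam0) {Φ : Type*} (Bf : W.relSys.Dom → Φ → ℂ) (φ : W.relSys.Dom → Φ) (B₀ : ℝ)
    (hB₀ : 0 ≤ B₀) (hterm : ∀ X ∈ W.relCubeSys.adm, ‖Bf X (φ X)‖ ≤ B₀ * Real.exp (-κ * relTreeLen X.1 (X.1 \ W.Z))) :
    ‖∑ X ∈ W.relCubeSys.adm, Bf X (φ X)‖ ≤ B₀ * (RelAnimal.Krel (4 * 2 ^ d) (3 ^ d - 1) + 1) * (W.Omega \ OmegaNext).card := by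
  have h := W.relCubeSys.scaleBound_Gamma W.degreeLE c₀_nonneg W.relAnimalLeaf hκ (cellsOf W.B OmegaNext)
    (cellsOf_mono h35) Bf φ B₀ hB₀ hterm
  have hc : (W.relCubeSys.Omega \ cellsOf W.B OmegaNext).card = (W.Omega \ OmegaNext).card := by
    show (cellsOf W.B W.Omega \ cellsOf W.B OmegaNext).card = (W.Omega \ OmegaNext).card
    rw [← cellsOf_sdiff, card_cellsOf (Finset.sdiff_subset.trans W.omega_subset)]
  exact h.trans (le_of_eq (congrArg
    (fun n : ℕ => B₀ * (RelAnimal.Krel (4 * 2 ^ d) (3 ^ d - 1) + 1) * (n : ℝ)) hc))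

/-- d = 4: the constants of the concrete carrier are `c₀ = 4·2^4 = 64`, `Δ = 3^4 − 1 = 80`. [folklore] -/
theorem consts_four : (4 * 2 ^ 4 : ℝ) = 64 ∧ (3 ^ 4 - 1 : ℕ) = 80 := by norm_num

/-- d = 4: `RelAnimal.kapparel 64 80 = 64·(log(2·81²) + 81 log 2) = 64(log 13122 + 81 log 2) < 4215` (≈ 4.2·10³; the constant is
not optimised — print: "κ sufficiently large"). [folklore] -/
theorem kapparel_four_lt : RelAnimal.kapparel (4 * 2 ^ 4) (3 ^ 4 - 1) < 4215 := by
  have h80 : ((3 ^ 4 - 1 : ℕ) : ℝ) = 80 := by norm_num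
  have hlog : Real.log 13122 ≤ 14 * Real.log 2 := by
    have h : Real.log 13122 ≤ Real.log ((2 : ℝ) ^ 14) := Real.log_le_log (by norm_num) (by norm_num)
    rwa [Real.log_pow] at h
  have h2 := Real.log_two_lt_d9
  have h2' := Real.log_two_gt_d9
  have hval : RelAnimal.kapparel (4 * 2 ^ 4) (3 ^ 4 - 1) = 64 * (Real.log 13122 + 81 * Real.log 2) := by
    simp only [RelAnimal.kapparel, RelAnimal.arel, B12TreeDecay.a₀, h80]
    norm_num
  rw [hval]
  nlinarith

end Window

end

end Literature.MathematicalPhysics.QuantumFieldTheory.Balaban1983to89.B14.RelTreeLength
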